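import Summits.HodgeConjecture.CorCM.OcticWeilFourfoldTwoTransitiveOfSimple
import Summits.HodgeConjecture.CorCM.CyclicSexticInducedType
import HarnessLib

/-!
# COR-CM — the Hodge conjecture for `B^n × E^a`, `B` ANY SIMPLE CM abelian FOURFOLD whose CM field contains the CM field `k`
# of the elliptic curve `E`, GIVEN ONLY Markman's theorems (fourfolds of Weil type; hyperbolic sixfolds): CAPSTONE

Cell `pub-hodgecm2` (COR-CM), seat b30 gen 19 (2026-08-21); count-neutral own lane OCTIC-WEIL22, capstone of gens 18–19
(`CorCM/OcticCurveFourfold*`: `k`-signature `(1,3)`/`(3,1)` modulo Markman's SIXFOLD theorem, any `B`;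
`CorCM/OcticWeilFourfold*`: `k`-signature `(2,2)` modulo Markman's FOURFOLD theorem, `B` simple — Dodson's `2`-transitivity).
Theorems only, no definition, no named fact, no `sorry`.  HONEST FRAMING: CONDITIONAL on the TWO displayed named facts
`HodgeTheory.Markman2025_weilClasses_algebraic_abelianFourfold` and `HodgeTheory.Markman2025_weilClasses_algebraic_hyperbolicSixfold`
(E. Markman, arXiv:2502.03415 / 2509.23403, UNREFEREED; typed in the tree as records); `HC_CM` is not asserted; no case of the
Hodge conjecture is claimed unconditionally here.

THE CASE SPLIT.  `K` a CM field of degree `8`, `i : k → K` with `k` imaginary quadratic, `Φ` a CM type of `K` realised by a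
SIMPLE `B`, `τ : k → ℂ`, and `c = #{s ∈ Φ | s ∘ i = τ} ∈ {0, …, 4}` the `k`-signature `(c, 4 − c)`:
* `c = 0` or `c = 4` is impossible: `Φ` would be a whole fibre of `Hom(K, ℂ) → Hom(k, ℂ)`, induced from `k` (`B ∼ E⁴`), and
  two embeddings of that fibre would have the same `Aut(ℂ)`-pattern — Shimura §8.2 Prop. 26
  (`not_isSimple_of_isCMTypeRealisation_of_ne`): `not_isSimple_of_card_filter_eq_zero/…_eq_four`;
* `c = 1`, `c = 3`: gen 18's `OcticCurveFourfold.hodgeConjectureFor_biproduct_comp_vec_of_markmanSixfold{,_of_card_eq_three}`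
  (no simplicity needed; Markman's sixfold theorem for the Weil sixfold `B × E × E`);
* `c = 2`: gen 19's `OcticWeilFourfold.hodgeConjectureFor_biproduct_comp_vec_of_isSimple_of_markman₂` (`B` of Weil type,
  degenerate; Dodson 1984 §3.3.2 ⟹ `2`-transitivity; Markman's fourfold theorem for `W_k(B)`).

* **`hodgeConjectureFor_biproduct_comp_vec_of_isSimple_of_markman`** — `B ⊨ (K; Φ)` SIMPLE, `[K:ℚ] = 8`, `i : k → K`,
  `[k:ℚ] = 2`, `E ⊨ (k; Ψ)`: `HodgeConjectureFor (⨁_j ![B, E] (κ j))` for EVERY `κ : Fin N → Fin 2` — all `B^n × E^a`, any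
  order — GIVEN ONLY the two Markman facts; `…_of_avDominatedBy_…` — and for everything dominated by such a product.
In words: **for every simple CM abelian fourfold `B` and every imaginary quadratic field `k ⊂ End⁰(B) = K`, the Hodge
conjecture holds for all products of copies of `B` and of the CM elliptic curve of `k`, modulo Markman's two theorems.**
(`B^n` alone, any simple CM fourfold, modulo the fourfold theorem: lit-pohlmann's `Pohlmann1968.SimpleCMFourfoldPowersHodgeConjecture`.)
[cite: Markman2025SurveySecant, Thm. 1.2] [cite: Markman2025SecantWeil, Thm 1.5.1] [cite: Dodson1984, §3.3.2 Theorem]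
[cite: Shimura1998, §8.2 Prop. 26] [cite: MoonenZarhin1995Duke, Thm. 2.4] [cite: MoonenZarhin1999LowDim, Thm. 0.1 (a)]

## References
* [Markman2025SurveySecant] E. Markman, arXiv:2509.23403, Thm. 1.2 (fourfolds).  [Markman2025SecantWeil] E. Markman,
  arXiv:2502.03415, Thm 1.5.1 (hyperbolic sixfolds).  [Dodson1984] B. Dodson, Trans. AMS 283 (1984), §3.3.2 Theorem.
  [Shimura1998] G. Shimura, *Abelian varieties with complex multiplication and modular functions*, §8.2 Prop. 26, §18.2.
  [MoonenZarhin1995Duke] Duke Math. J. 77 (1995), Thm. 2.4.  [MoonenZarhin1999LowDim] Math. Ann. 315 (1999), Thm. 0.1 (a).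
  [Pohlmann1968] H. Pohlmann, Ann. of Math. 88 (1968), Thm 1, §3.  [MumfordAV1970] D. Mumford, *Abelian Varieties*, §19.
-/

noncomputable section

open CategoryTheory CategoryTheory.Limits NumberField

namespace Summit.HodgeConjecture.CorCM.SimpleCMFourfoldCurve

open Literature.AlgebraicGeometry Literature.AlgebraicGeometry.Motives Literature.AlgebraicGeometry.HodgeTheory
open Literature.AlgebraicGeometry.ComplexMultiplication (IsCMTypeRealisation not_isSimple_of_isCMTypeRealisation_of_ne)
open Literature.AlgebraicTopology.SingularHomology
open Summit.HodgeConjecture.CorCM.OcticCurveFourfold (card_filter_comp_eq_four comp_injective)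
open Summit.HodgeConjecture.CorCM.NonGaloisField (conjugate_comp)

open scoped Classical

/-! ## §1 A simple CM fourfold meets both fibres of an imaginary quadratic subfield -/

section Fibres

variable {K : Type} [Field K] [NumberField K] [IsCMField K] {k : Type} [Field k] [NumberField k] [IsCMField k]
  {Φ : CMType K} {B : AbelianVariety ℂ} {ιB : 𝓞 K →+* End B} {θB : K →+* Module.End ℂ (complexBetti B.X 1)}

omit [IsCMField K] [IsCMField k] in
/-- **Complementary counts**: conjugation maps the members of `Φ` over `τ̄` bijectively onto the non-members over `τ`, so
`#{s ∈ Φ | s ∘ i = τ̄} + #{s ∈ Φ | s ∘ i = τ} = 4`. [cite: Shimura1998, §18.2 Lemma] -/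
theorem card_filter_conjugate_add (h8 : Module.finrank ℚ K = 8) (h2 : Module.finrank ℚ k = 2) (i : k →+* K)
    (Φ : CMType K) (τ : k →+* ℂ) :
    (Finset.univ.filter fun s : K →+* ℂ => s.comp i = ComplexEmbedding.conjugate τ ∧ s ∈ Φ.1).card +
      (Finset.univ.filter fun s : K →+* ℂ => s.comp i = τ ∧ s ∈ Φ.1).card = 4 := by
  have hcc : ∀ s : K →+* ℂ, ComplexEmbedding.conjugate (ComplexEmbedding.conjugate s) = s :=
    ComplexEmbedding.involutive_conjugate K
  have hcck : ComplexEmbedding.conjugate (ComplexEmbedding.conjugate τ) = τ := ComplexEmbedding.involutive_conjugate k τ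
  have himg : (Finset.univ.filter fun s : K →+* ℂ => s.comp i = ComplexEmbedding.conjugate τ ∧ s ∈ Φ.1).image
      ComplexEmbedding.conjugate = Finset.univ.filter fun s : K →+* ℂ => s.comp i = τ ∧ s ∉ Φ.1 := by
    ext s'
    simp only [Finset.mem_image, Finset.mem_filter, Finset.mem_univ, true_and]
    constructor
    · rintro ⟨s, ⟨hs, hsΦ⟩, rfl⟩
      refine ⟨by rw [conjugate_comp, hs, hcck], ?_⟩
      rwa [← Φ.2 s]
    · rintro ⟨hs', hs'Φ⟩
      refine ⟨ComplexEmbedding.conjugate s', ⟨by rw [conjugate_comp, hs'], ?_⟩, hcc s'⟩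
      have h := Φ.2 (ComplexEmbedding.conjugate s')
      rw [hcc] at h
      exact h.2 hs'Φ
  rw [← Finset.card_image_of_injective _ (ComplexEmbedding.involutive_conjugate K).injective, himg]
  have h4 := card_filter_comp_eq_four i h8 h2 τ
  have hsplit := Finset.card_filter_add_card_filter_not
    (s := Finset.univ.filter fun s : K →+* ℂ => s.comp i = τ) (fun s => s ∈ Φ.1)
  rw [Finset.filter_filter, Finset.filter_filter, h4] at hsplit
  omega

omit [IsCMField K] in
/-- **No member of `Φ` over `τ` ⟹ `B` is not simple.**  Then `Φ` is the whole fibre of `τ̄` (induced from `k`: `B ∼ E_τ̄⁴`),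
and two distinct embeddings of that fibre have the same `Aut(ℂ)`-pattern in `Φ` (`ρ ∘ s ∈ Φ ⟺ ρ ∘ τ̄ = τ̄`) — Shimura
§8.2 Prop. 26, `not_isSimple_of_isCMTypeRealisation_of_ne`. [cite: Shimura1998, §8.2 Prop. 26 and §8.4] -/
theorem not_isSimple_of_card_filter_eq_zero (h8 : Module.finrank ℚ K = 8) (h2 : Module.finrank ℚ k = 2) (i : k →+* K)
    (hB : IsCMTypeRealisation Φ B ιB θB) (τ : k →+* ℂ)
    (h0 : (Finset.univ.filter fun s : K →+* ℂ => s.comp i = τ ∧ s ∈ Φ.1).card = 0) : ¬ B.IsSimple := by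
  have hττ : ComplexEmbedding.conjugate τ ≠ τ := QuarticCM.conjugate_ne τ
  have hk : ∀ σ : k →+* ℂ, σ = τ ∨ σ = ComplexEmbedding.conjugate τ := fun σ =>
    QuarticCM.eq_or_eq_conjugate_of_quadratic h2 τ σ
  have hcck : ComplexEmbedding.conjugate (ComplexEmbedding.conjugate τ) = τ := ComplexEmbedding.involutive_conjugate k τ
  -- no member of `Φ` lies over `τ`
  have hnot : ∀ s : K →+* ℂ, s.comp i = τ → s ∉ Φ.1 := fun s hs hsΦ => by
    have hmem : s ∈ Finset.univ.filter fun s : K →+* ℂ => s.comp i = τ ∧ s ∈ Φ.1 :=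
      Finset.mem_filter.2 ⟨Finset.mem_univ _, hs, hsΦ⟩
    rw [Finset.card_eq_zero.1 h0] at hmem
    exact Finset.notMem_empty _ hmem
  -- so `Φ` is the fibre of `τ̄`
  have hΦ : ∀ u : K →+* ℂ, u ∈ Φ.1 ↔ u.comp i = ComplexEmbedding.conjugate τ := by
    intro u
    constructor
    · intro hu
      rcases hk (u.comp i) with h | h
      · exact absurd hu (hnot u h)
      · exact h
    · intro hu
      rw [Φ.2 u]
      exact hnot _ (by rw [conjugate_comp, hu, hcck])
  -- two distinct embeddings over `τ̄`
  have h4 := card_filter_comp_eq_four i h8 h2 (ComplexEmbedding.conjugate τ)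
  obtain ⟨s, hs, t, ht, hst⟩ : ∃ s ∈ (Finset.univ.filter fun s : K →+* ℂ => s.comp i = ComplexEmbedding.conjugate τ),
      ∃ t ∈ (Finset.univ.filter fun s : K →+* ℂ => s.comp i = ComplexEmbedding.conjugate τ), s ≠ t :=
    Finset.one_lt_card.1 (by rw [h4]; norm_num)
  have hs' : s.comp i = ComplexEmbedding.conjugate τ := (Finset.mem_filter.1 hs).2
  have ht' : t.comp i = ComplexEmbedding.conjugate τ := (Finset.mem_filter.1 ht).2
  refine not_isSimple_of_isCMTypeRealisation_of_ne hB hst fun ρ => ?_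
  rw [hΦ, hΦ, RingHom.comp_assoc, RingHom.comp_assoc, hs', ht']

omit [IsCMField K] in
/-- **All four embeddings over `τ` in `Φ` ⟹ `B` is not simple** (no member over `τ̄`; the previous lemma at `τ̄`).
[cite: Shimura1998, §8.2 Prop. 26 and §8.4] -/
theorem not_isSimple_of_card_filter_eq_four (h8 : Module.finrank ℚ K = 8) (h2 : Module.finrank ℚ k = 2) (i : k →+* K)
    (hB : IsCMTypeRealisation Φ B ιB θB) (τ : k →+* ℂ)
    (h4c : (Finset.univ.filter fun s : K →+* ℂ => s.comp i = τ ∧ s ∈ Φ.1).card = 4) : ¬ B.IsSimple := by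
  have h := card_filter_conjugate_add h8 h2 i Φ τ
  exact not_isSimple_of_card_filter_eq_zero h8 h2 i hB (ComplexEmbedding.conjugate τ) (by omega)

omit [IsCMField K] [IsCMField k] in
/-- The count over `τ` is at most `4` (the fibre of `τ` has four elements). [folklore] -/
theorem card_filter_le_four (h8 : Module.finrank ℚ K = 8) (h2 : Module.finrank ℚ k = 2) (i : k →+* K) (Φ : CMType K)
    (τ : k →+* ℂ) : (Finset.univ.filter fun s : K →+* ℂ => s.comp i = τ ∧ s ∈ Φ.1).card ≤ 4 := by
  have h := card_filter_conjugate_add h8 h2 i Φ τ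
  omega

end Fibres

/-! ## §2 The capstone -/

section Main

variable {K : Type} [Field K] [NumberField K] [IsCMField K] {k : Type} [Field k] [NumberField k] [IsCMField k]
  {N : ℕ} {Φ : CMType K} {B : AbelianVariety ℂ} {ιB : 𝓞 K →+* End B} {θB : K →+* Module.End ℂ (complexBetti B.X 1)}
  {Ψ : CMType k} {E : AbelianVariety ℂ} {ιE : 𝓞 k →+* End E} {θE : k →+* Module.End ℂ (complexBetti E.X 1)}

/-- **THE HODGE CONJECTURE FOR EVERY PRODUCT OF COPIES OF A SIMPLE CM ABELIAN FOURFOLD AND THE CM CURVE OF AN IMAGINARY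
QUADRATIC SUBFIELD OF ITS CM FIELD, GIVEN ONLY MARKMAN'S TWO THEOREMS.**  `K` ANY CM field of degree `8`, `k` imaginary
quadratic (`[k:ℚ] = 2`) with `i : k → K`; `B ⊨ (K; Φ)` a SIMPLE CM abelian fourfold and `E ⊨ (k; Ψ)` a CM elliptic curve
(realisations on `H¹`).  Then for every `κ : Fin N → Fin 2`, every rational `(q,q)`-class on `⨁_j ![B, E] (κ j)` — `B^n × E^a`,
all `n, a`, any order — is algebraic.  Case split on the `k`-signature `(c, 4 − c)` of `Φ` at a member `τ` of `Ψ`: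
`c ∈ {0, 4}` contradicts simplicity (§1), `c ∈ {1, 3}` is gen 18's sixfold theorem, `c = 2` is gen 19's fourfold theorem
(Dodson's `2`-transitivity from simplicity).  Displayed leaves: `Markman2025_weilClasses_algebraic_abelianFourfold`,
`Markman2025_weilClasses_algebraic_hyperbolicSixfold` (UNREFEREED); nothing else. [cite: Markman2025SurveySecant, Thm. 1.2]
[cite: Markman2025SecantWeil, Thm 1.5.1] [cite: Dodson1984, §3.3.2 Theorem] [cite: Shimura1998, §8.2 Prop. 26] -/
theorem hodgeConjectureFor_biproduct_comp_vec_of_isSimple_of_markman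
    (hW4 : Markman2025_weilClasses_algebraic_abelianFourfold) (hM6 : Markman2025_weilClasses_algebraic_hyperbolicSixfold)
    (h8 : Module.finrank ℚ K = 8) (h2 : Module.finrank ℚ k = 2) (i : k →+* K)
    (hB : IsCMTypeRealisation Φ B ιB θB) (hS : B.IsSimple) (hE : IsCMTypeRealisation Ψ E ιE θE) (κ : Fin N → Fin 2) :
    HodgeConjectureFor (⨁ fun j => (![B, E] : Fin 2 → AbelianVariety ℂ) (κ j)).dim
      (⨁ fun j => (![B, E] : Fin 2 → AbelianVariety ℂ) (κ j)).X := by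
  -- a member `τ` of `Ψ` and a `√-d` datum of `k`
  obtain ⟨a₀⟩ : Nonempty (k →+* ℂ) := inferInstance
  obtain ⟨τ, hτΨ⟩ : ∃ τ, τ ∈ Ψ.1 := by
    by_cases h : a₀ ∈ Ψ.1
    · exact ⟨a₀, h⟩
    · exact ⟨ComplexEmbedding.conjugate a₀, (Ψ.2 _).2 (by rw [ComplexEmbedding.involutive_conjugate k a₀]; exact h)⟩
  obtain ⟨δ, d, hd, hδ⟩ := CyclicSextic.exists_sq_eq_neg_nat_of_isTotallyComplex k h2
  -- the `k`-signature `(c, 4 - c)`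
  set c := (Finset.univ.filter fun s : K →+* ℂ => s.comp i = τ ∧ s ∈ Φ.1).card with hc
  have hc4 : c ≤ 4 := card_filter_le_four h8 h2 i Φ τ
  interval_cases c
  · exact absurd hS (not_isSimple_of_card_filter_eq_zero h8 h2 i hB τ hc.symm)
  · exact OcticCurveFourfold.hodgeConjectureFor_biproduct_comp_vec_of_markmanSixfold hM6 h8 h2 i hd hδ hB hE hτΨ hc.symm κ
  · exact OcticWeilFourfold.hodgeConjectureFor_biproduct_comp_vec_of_isSimple_of_markman₂ hW4 h8 h2 i hB hS hE hτΨ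
      hc.symm κ
  · exact OcticCurveFourfold.hodgeConjectureFor_biproduct_comp_vec_of_markmanSixfold_of_card_eq_three hM6 h8 h2 i hd hδ hB
      hE hτΨ hc.symm κ
  · exact absurd hS (not_isSimple_of_card_filter_eq_four h8 h2 i hB τ hc.symm)

/-- **… and for every abelian variety dominated by such a product**: everything isogenous to an abelian subvariety or quotient
of some `B^n × E^a`, `B` a simple CM fourfold, `E` the CM curve of an imaginary quadratic subfield of its CM field, modulo
Markman's two theorems. [cite: Markman2025SurveySecant, Thm. 1.2] [cite: Markman2025SecantWeil, Thm 1.5.1] [cite: MumfordAV1970, §19] -/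
theorem hodgeConjectureFor_of_avDominatedBy_comp_vec_of_isSimple_of_markman
    (hW4 : Markman2025_weilClasses_algebraic_abelianFourfold) (hM6 : Markman2025_weilClasses_algebraic_hyperbolicSixfold)
    (h8 : Module.finrank ℚ K = 8) (h2 : Module.finrank ℚ k = 2) (i : k →+* K)
    (hB : IsCMTypeRealisation Φ B ιB θB) (hS : B.IsSimple) (hE : IsCMTypeRealisation Ψ E ιE θE) (κ : Fin N → Fin 2)
    {C : AbelianVariety ℂ} (hC : Domination.AVDominatedBy C (⨁ fun j => (![B, E] : Fin 2 → AbelianVariety ℂ) (κ j))) :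
    HodgeConjectureFor C.dim C.X :=
  Domination.hodgeConjectureFor_of_avDominatedBy
    (hodgeConjectureFor_biproduct_comp_vec_of_isSimple_of_markman hW4 hM6 h8 h2 i hB hS hE κ) hC

end Main

end Summit.HodgeConjecture.CorCM.SimpleCMFourfoldCurve

end
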